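import Summits.PneNP.PneNP.Theorems.OneSliceSingleThresholdCliqueMinusEdgeInvisible

/-!
# A planted `k`-clique is invisible in the supercritical dose `G(n, n^{-σ})`, `σ < 2/(k-1)`

Route `OneSlice`, crux `Summit.PneNP.PneNP.Theses.OneSlice.SingleThreshold` (stmt-PneNP-2833), line
`two-round-exposure`: the registered stub `stub_doseTrivialBelowCritical` (stub K, the calibration of
the dose dial at its dense end).

**What.** Fix `k ≥ 3` and `0 < σ < 2/(k-1)`, and let `R ∼ G(n, ρ)` with the dose density
`ρ = n^{-σ}`, `A` a uniform `k`-set and `K_A = cliqueVec A`. Then there is `c₂ > 0` (here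
`c₂ = (2 - σ(k-1))/4`) such that, eventually in `n`, for EVERY test `f` (no monotonicity, no size
bound): `|E_{R,A} f(R ∪ K_A) − E_R f(R)| ≤ n^{-c₂}`. Below the critical exponent `2/(k-1)` every
subgraph of `K_k` (including `K_k` itself) has expected count `→ ∞` in `G(n, ρ)`, so planting one
`k`-clique at a random position is statistically invisible.

**How** (the second-moment / Cauchy–Schwarz template of Rossman 2010, App. B, Lemma 23, for the
planted family `Q_A = K_A`; the generic lemmas are in
`Literature/Computability/Complexity/GnpPlantedLikelihoodRatio.lean`, the overlap count
`sum_card_inter_le` in `OneSliceSingleThresholdCliqueMinusEdgeInvisible.lean`).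
* `Pr_A[f(y ∪ K_A) = 1] − f(y) = (1/N) Σ_A (f(y ∪ K_A) − f(y))`, `N = C(n,k)`.
* Planting identity (`sum_gnpWeight_mul_sup_eq_sum_lr`): `E[g(R ∪ t)] = E[L_t(R) g(R)]`,
  `L_t(x) = ρ^{-e(t)} [t ⊆ x]`; hence the advantage is `(1/N) E[f · D]`, `D = Σ_A (L_{K_A} − 1)`, and
  by Cauchy–Schwarz `E[f D]² ≤ E[D²] = Σ_{A,A'} (ρ^{-e(K_A ∩ K_{A'})} − 1)` (`sq_sum_adv_le`).
* Overlaps (`edgeCount_inf_cliqueVec_le`): `e(K_A ∩ K_{A'}) ≤ C(|A ∩ A'|, 2)`; the `k`-sets meeting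
  `A` in `j` points are at most `C(k,j) k^j N / n^j`, whence
  `E[D²] ≤ N² Σ_{j ≤ k} C(k,j) k^j n^{-j} (ρ^{-C(j,2)} − 1)` (`secondMoment_cliques_le`), and
  `n^{-j} (ρ^{-C(j,2)} − 1) ≤ n^{-(2 - σ(k-1))}` for `j ≤ k` (`rpow_cliqueOverlap_le`: the exponent is
  `j(σ(j-1)/2 − 1) ≤ 2(σ(k-1)/2 − 1)` for `j ≥ 2`, and the term vanishes for `j ≤ 1`). So
  `advantage² ≤ (k+1) 2^k k^k n^{-(2-σ(k-1))} ≤ n^{-(2-σ(k-1))/2}` eventually.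

## References

* B. Rossman, *The monotone complexity of k-clique on random graphs*, FOCS 2010, 193–201; SIAM J.
  Comput. 43 (2014) 256–279 — Appendix B, Lemma 23 (pp. 13–14), the second-moment template
  [Rossman2010]; the contiguity of a planted strictly-supercritical pattern is folklore
  (S. Janson, T. Łuczak, A. Ruciński, *Random Graphs* (2000), §3).
-/

noncomputable section

set_option linter.dupNamespace false

open Finset Filter

open scoped Classical Topology

namespace Summit.PneNP.PneNP.Theorems.SingleThreshold

open Literature.Computability.Complexity
open Summit.PneNP.PneNP.Theorems.SingleThreshold.Negative (Edges)

variable {n : ℕ}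

/-! ### Overlaps of two cliques -/

/-- **Overlap of two cliques**: `e(K_A ∩ K_{A'}) ≤ C(|A ∩ A'|, 2)` (the common edges lie in
`K_{A ∩ A'}`). [folklore] -/
theorem edgeCount_inf_cliqueVec_le (A A' : Finset (Fin n)) :
    edgeCount (cliqueVec A ⊓ cliqueVec A') ≤ (#(A ∩ A')).choose 2 := by
  change #(onSet (cliqueVec A ⊓ cliqueVec A')) ≤ _
  rw [onSet_inf]
  calc #(onSet (cliqueVec A) ∩ onSet (cliqueVec A'))
      ≤ #(onSet (cliqueVec (A ∩ A'))) := by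
        refine card_le_card fun d hd => ?_
        rw [mem_inter, mem_onSet, mem_onSet] at hd
        rw [mem_onSet, cliqueVec_eq_true_iff_endpts, subset_inter_iff,
          ← cliqueVec_eq_true_iff_endpts, ← cliqueVec_eq_true_iff_endpts]
        exact hd
    _ ≤ (#(A ∩ A')).choose 2 := card_onSet_cliqueVec_le _

/-- **The second-moment double sum over the `k`-sets `A, A'`** is at most
`C(n,k)² Σ_{j ≤ k} C(k,j) k^j n^{-j} (q^{-C(j,2)} - 1)` (`0 < q ≤ 1`, `k ≤ n`, `0 < n`). [folklore] -/
theorem secondMoment_cliques_le {k : ℕ} (hkn : k ≤ n) (hn : 0 < n) {q : ℝ} (hq0 : 0 < q)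
    (hq1 : q ≤ 1) :
    ∑ A ∈ powersetCard k (univ : Finset (Fin n)), ∑ A' ∈ powersetCard k (univ : Finset (Fin n)),
        ((q ^ edgeCount (cliqueVec A ⊓ cliqueVec A'))⁻¹ - 1) ≤
      (n.choose k : ℝ) ^ 2 *
        ∑ j ∈ range (k + 1), (k.choose j : ℝ) * (k : ℝ) ^ j / (n : ℝ) ^ j *
          ((q ^ j.choose 2)⁻¹ - 1) := by
  set 𝒜 := powersetCard k (univ : Finset (Fin n))
  set U : ℕ → ℝ := fun j => (q ^ j.choose 2)⁻¹ - 1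
  set S : ℝ := ∑ j ∈ range (k + 1), (k.choose j : ℝ) * (k : ℝ) ^ j / (n : ℝ) ^ j * U j
  have hU0 : ∀ j, 0 ≤ U j := fun j =>
    sub_nonneg.2 ((one_le_inv₀ (pow_pos hq0 _)).2 (pow_le_one₀ hq0.le hq1))
  have hpt : ∀ A A' : Finset (Fin n),
      (q ^ edgeCount (cliqueVec A ⊓ cliqueVec A'))⁻¹ - 1 ≤ U (#(A ∩ A')) := fun A A' =>
    sub_le_sub_right (inv_anti₀ (pow_pos hq0 _)
      (pow_le_pow_of_le_one hq0.le hq1 (edgeCount_inf_cliqueVec_le A A'))) 1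
  have hinner : ∀ A ∈ 𝒜,
      ∑ A' ∈ 𝒜, ((q ^ edgeCount (cliqueVec A ⊓ cliqueVec A'))⁻¹ - 1) ≤ (n.choose k : ℝ) * S := by
    intro A hA
    have hAk : #A = k := (mem_powersetCard.1 hA).2
    calc _ ≤ ∑ A' ∈ 𝒜, U (#(A ∩ A')) := sum_le_sum fun A' _ => hpt A A'
      _ ≤ (n.choose k : ℝ) * S := sum_card_inter_le hkn hn hAk U hU0
  calc _ ≤ ∑ A ∈ 𝒜, (n.choose k : ℝ) * S := sum_le_sum hinner
    _ = (n.choose k : ℝ) ^ 2 * S := by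
        rw [sum_const, card_powersetCard, card_univ, Fintype.card_fin, nsmul_eq_mul]
        ring

/-! ### Every subgraph of `K_k` is strictly supercritical in the dose -/

/-- **Exponent bookkeeping in the supercritical dose.** For `k ≥ 3`, `0 < σ < 2/(k-1)`, `n ≥ 1`
and `j ≤ k`, with `ρ = n^{-σ}`: `n^{-j} (ρ^{-C(j,2)} - 1) ≤ n^{-(2 - σ(k-1))}`. For `j ≤ 1` the left
side vanishes; for `2 ≤ j ≤ k` the exponent is `σ C(j,2) - j = j (σ(j-1)/2 - 1) ≤ 2 (σ(k-1)/2 - 1)`.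
[folklore] -/
theorem rpow_cliqueOverlap_le {k : ℕ} (hk : 3 ≤ k) {σ : ℝ} (hσ : 0 < σ)
    (hσk : σ < 2 / ((k : ℝ) - 1)) (hn : 1 ≤ n) {j : ℕ} (hj : j ≤ k) :
    ((n : ℝ) ^ j)⁻¹ * ((((n : ℝ) ^ (-σ)) ^ j.choose 2)⁻¹ - 1) ≤
      (n : ℝ) ^ (-(2 - σ * ((k : ℝ) - 1))) := by
  have hK : (3 : ℝ) ≤ k := by exact_mod_cast hk
  have hK1 : (0 : ℝ) < (k : ℝ) - 1 := by linarith
  have hσk' : σ * ((k : ℝ) - 1) < 2 := (lt_div_iff₀ hK1).1 hσk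
  have hn0 : (0 : ℝ) < n := by exact_mod_cast hn
  have hn1 : (1 : ℝ) ≤ n := by exact_mod_cast hn
  rcases Nat.lt_or_ge j 2 with hj2 | hj2
  · -- `j ≤ 1`: the term vanishes
    rw [Nat.choose_eq_zero_of_lt hj2, pow_zero, inv_one, sub_self, mul_zero]
    exact Real.rpow_nonneg hn0.le _
  · -- `2 ≤ j`: compare exponents
    have hρM : (((n : ℝ) ^ (-σ)) ^ j.choose 2)⁻¹ = (n : ℝ) ^ (σ * (j.choose 2 : ℕ)) := by
      rw [← Real.rpow_mul_natCast hn0.le, neg_mul, Real.rpow_neg hn0.le, inv_inv]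
    have hnj : ((n : ℝ) ^ j)⁻¹ = (n : ℝ) ^ (-(j : ℝ)) := by
      rw [Real.rpow_neg hn0.le, Real.rpow_natCast]
    have hdrop : ((n : ℝ) ^ j)⁻¹ * ((((n : ℝ) ^ (-σ)) ^ j.choose 2)⁻¹ - 1) ≤
        ((n : ℝ) ^ j)⁻¹ * (((n : ℝ) ^ (-σ)) ^ j.choose 2)⁻¹ :=
      mul_le_mul_of_nonneg_left (by linarith) (by positivity)
    refine hdrop.trans ?_
    rw [hρM, hnj, ← Real.rpow_add hn0]
    refine Real.rpow_le_rpow_of_exponent_le hn1 ?_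
    have hJ2 : (2 : ℝ) ≤ j := by exact_mod_cast hj2
    have hJk : (j : ℝ) ≤ k := by exact_mod_cast hj
    have h2 : σ * ((j : ℝ) - 1) ≤ σ * ((k : ℝ) - 1) := mul_le_mul_of_nonneg_left (by linarith) hσ.le
    have h3 : (j : ℝ) * (σ * ((j : ℝ) - 1) / 2 - 1) ≤ (j : ℝ) * (σ * ((k : ℝ) - 1) / 2 - 1) :=
      mul_le_mul_of_nonneg_left (by linarith) (by positivity)
    have h4 : (j : ℝ) * (σ * ((k : ℝ) - 1) / 2 - 1) ≤ 2 * (σ * ((k : ℝ) - 1) / 2 - 1) :=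
      mul_le_mul_of_nonpos_right hJ2 (by linarith)
    rw [Nat.cast_choose_two]
    linarith

/-! ### The stub -/

/-- **Stub K of line `two-round-exposure` — a planted `k`-clique is invisible in the supercritical
dose.** For `k ≥ 3` and `0 < σ < 2/(k−1)` there is `c₂ > 0` (here `c₂ = (2 − σ(k−1))/4`) such that
eventually in `n`, for EVERY test `f` (no monotonicity, no size bound):
`|E_{R,A} f(R ∪ K_A) − E_R f(R)| ≤ n^{-c₂}`, `R ∼ G(n, n^{-σ})`, `A` a uniform `k`-set. Proof:
`Pr_A[f(y ∪ K_A)] − f(y) = (1/C(n,k)) Σ_A (f(y ∪ K_A) − f(y))`, planting identity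
(`sum_gnpWeight_mul_sup_eq_sum_lr`) and exchange of sums (`sum_mul_sum_sub_eq`), Cauchy–Schwarz
(`sq_sum_adv_le`), the overlap count `secondMoment_cliques_le` and the exponent bookkeeping
`rpow_cliqueOverlap_le` (every subgraph of `K_k` is strictly supercritical in `G(n, n^{-σ})` iff
`σ < 2/(k−1)`); the second-moment template of Rossman's Lemma 23.
[folklore; cf. Rossman2010, App. B, Lemma 23 (pp. 13–14) for the template] -/
theorem stub_doseTrivialBelowCritical :
    ∀ k : ℕ, 3 ≤ k → ∀ σ : ℝ, 0 < σ → σ < 2 / ((k : ℝ) - 1) → ∃ c₂ : ℝ, 0 < c₂ ∧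
      ∀ᶠ n : ℕ in atTop, ∀ f : (Edges n → Bool) → Bool,
        |∑ y : Edges n → Bool, gnpWeight n ((n : ℝ) ^ (-σ)) y *
            (kSubsetProb n k (fun A => f (y ⊔ cliqueVec A) = true) -
              (if f y = true then (1 : ℝ) else 0))| ≤ (n : ℝ) ^ (-c₂) := by
  intro k hk σ hσ hσk
  have hK : (3 : ℝ) ≤ k := by exact_mod_cast hk
  have hk1 : (0 : ℝ) < (k : ℝ) - 1 := by linarith
  have hσk' : σ * ((k : ℝ) - 1) < 2 := (lt_div_iff₀ hk1).1 hσk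
  set a : ℝ := 2 - σ * ((k : ℝ) - 1) with ha
  have ha0 : 0 < a := by rw [ha]; linarith
  refine ⟨a / 4, by positivity, ?_⟩
  have hev : ∀ᶠ n : ℕ in atTop, ((k + 1 : ℕ) : ℝ) * (2 ^ k * (k : ℝ) ^ k) ≤ (n : ℝ) ^ (a / 2) :=
    ((tendsto_rpow_atTop (by positivity)).comp tendsto_natCast_atTop_atTop).eventually_ge_atTop _
  filter_upwards [eventually_ge_atTop k, hev] with n hkn hK₁
  intro f
  -- parameters at this `n`
  have hn : 0 < n := by omega
  have hn1' : 1 ≤ n := hn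
  have hn0 : (0 : ℝ) < n := by exact_mod_cast hn
  set ρ : ℝ := (n : ℝ) ^ (-σ)
  have hρ0 : 0 < ρ := Real.rpow_pos_of_pos hn0 _
  have hρ1 : ρ ≤ 1 :=
    Real.rpow_le_one_of_one_le_of_nonpos (by exact_mod_cast hn1') (neg_nonpos.2 hσ.le)
  have hN0 : (0 : ℝ) < n.choose k := by exact_mod_cast Nat.choose_pos hkn
  -- Step 0: the advantage averaged over the `k`-set `A`
  have hpt : ∀ y : Edges n → Bool,
      kSubsetProb n k (fun A => f (y ⊔ cliqueVec A) = true) - (if f y = true then (1 : ℝ) else 0) =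
        (1 / (n.choose k : ℝ)) * ∑ A ∈ powersetCard k (univ : Finset (Fin n)),
          ((if f (y ⊔ cliqueVec A) = true then (1 : ℝ) else 0) -
            (if f y = true then (1 : ℝ) else 0)) := by
    intro y
    unfold kSubsetProb
    rw [natCast_card_filter, sum_sub_distrib, sum_const, card_powersetCard, card_univ,
      Fintype.card_fin, nsmul_eq_mul, mul_sub, one_div, inv_mul_cancel_left₀ hN0.ne',
      div_eq_inv_mul]
  set 𝒜 := powersetCard k (univ : Finset (Fin n))
  set S : ℝ := ∑ j ∈ range (k + 1), (k.choose j : ℝ) * (k : ℝ) ^ j / (n : ℝ) ^ j *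
    ((ρ ^ j.choose 2)⁻¹ - 1)
  -- Step 1: planting identity and exchange of sums
  have step1 : ∑ y : Edges n → Bool, gnpWeight n ρ y *
        (kSubsetProb n k (fun A => f (y ⊔ cliqueVec A) = true) -
          (if f y = true then (1 : ℝ) else 0)) =
      (1 / (n.choose k : ℝ)) * ∑ y, gnpWeight n ρ y * ((if f y = true then (1 : ℝ) else 0) *
        ∑ A ∈ 𝒜, (((ρ ^ edgeCount (cliqueVec A))⁻¹ * if cliqueVec A ≤ y then 1 else 0) - 1)) := by
    calc _ = ∑ y : Edges n → Bool, gnpWeight n ρ y * ((1 / (n.choose k : ℝ)) *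
          ∑ A ∈ 𝒜, ((if f (y ⊔ cliqueVec A) = true then (1 : ℝ) else 0) -
            (if f y = true then (1 : ℝ) else 0))) := sum_congr rfl fun y _ => by rw [hpt y]
      _ = (1 / (n.choose k : ℝ)) * ∑ y : Edges n → Bool, gnpWeight n ρ y *
          ∑ A ∈ 𝒜, ((if f (y ⊔ cliqueVec A) = true then (1 : ℝ) else 0) -
            (if f y = true then (1 : ℝ) else 0)) := by
          rw [mul_sum]
          exact sum_congr rfl fun y _ => by ring
      _ = _ := congrArg (fun t => (1 / (n.choose k : ℝ)) * t)
          (sum_mul_sum_sub_eq 𝒜 (fun y => gnpWeight n ρ y)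
            (fun y => if f y = true then (1 : ℝ) else 0)
            (fun A y => if f (y ⊔ cliqueVec A) = true then (1 : ℝ) else 0)
            (fun A y => (ρ ^ edgeCount (cliqueVec A))⁻¹ * if cliqueVec A ≤ y then 1 else 0)
            (fun A _ => sum_gnpWeight_mul_sup_eq_sum_lr hρ0.ne' (cliqueVec A)
              (fun y => if f y = true then (1 : ℝ) else 0)))
  -- Step 2: Cauchy–Schwarz and the second moment of the planted likelihood ratio
  have hcore := sq_sum_adv_le 𝒜 (fun A => cliqueVec A) hρ0 hρ1 (fun y => f y = true)
  have hpairs : ∑ A ∈ 𝒜, ∑ A' ∈ 𝒜, ((ρ ^ edgeCount (cliqueVec A ⊓ cliqueVec A'))⁻¹ - 1) ≤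
      (n.choose k : ℝ) ^ 2 * S := secondMoment_cliques_le hkn hn hρ0 hρ1
  -- Step 3: every term of `S` is `≤ 2^k k^k n^{-a}`
  have hSle : S ≤ ((k + 1 : ℕ) : ℝ) * (2 ^ k * (k : ℝ) ^ k * (n : ℝ) ^ (-a)) := by
    calc S ≤ ∑ j ∈ range (k + 1), (2 ^ k * (k : ℝ) ^ k * (n : ℝ) ^ (-a)) := by
          refine sum_le_sum fun j hj => ?_
          have hjk : j ≤ k := Nat.lt_succ_iff.1 (mem_range.1 hj)
          have h1 := rpow_cliqueOverlap_le (n := n) hk hσ hσk hn1' hjk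
          have h2 : (k.choose j : ℝ) ≤ 2 ^ k := by exact_mod_cast Nat.choose_le_two_pow k j
          have h3 : (k : ℝ) ^ j ≤ (k : ℝ) ^ k := pow_le_pow_right₀ (by linarith) hjk
          have hU0 : 0 ≤ (ρ ^ j.choose 2)⁻¹ - 1 :=
            sub_nonneg.2 ((one_le_inv₀ (pow_pos hρ0 _)).2 (pow_le_one₀ hρ0.le hρ1))
          calc (k.choose j : ℝ) * (k : ℝ) ^ j / (n : ℝ) ^ j * ((ρ ^ j.choose 2)⁻¹ - 1)
              = ((k.choose j : ℝ) * (k : ℝ) ^ j) *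
                  (((n : ℝ) ^ j)⁻¹ * ((ρ ^ j.choose 2)⁻¹ - 1)) := by ring
            _ ≤ (2 ^ k * (k : ℝ) ^ k) * (n : ℝ) ^ (-a) :=
                mul_le_mul (mul_le_mul h2 h3 (by positivity) (by positivity)) h1
                  (mul_nonneg (by positivity) hU0) (by positivity)
            _ = 2 ^ k * (k : ℝ) ^ k * (n : ℝ) ^ (-a) := by ring
      _ = ((k + 1 : ℕ) : ℝ) * (2 ^ k * (k : ℝ) ^ k * (n : ℝ) ^ (-a)) := by
          rw [sum_const, card_range, nsmul_eq_mul]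
  -- Step 4: assemble
  rw [step1]
  refine abs_le_of_sq_le_sq ?_ (Real.rpow_nonneg hn0.le _)
  rw [mul_pow]
  calc (1 / (n.choose k : ℝ)) ^ 2 * (∑ y, gnpWeight n ρ y * ((if f y = true then (1 : ℝ) else 0) *
        ∑ A ∈ 𝒜, (((ρ ^ edgeCount (cliqueVec A))⁻¹ * if cliqueVec A ≤ y then 1 else 0) - 1))) ^ 2
      ≤ (1 / (n.choose k : ℝ)) ^ 2 * ((n.choose k : ℝ) ^ 2 * S) :=
        mul_le_mul_of_nonneg_left (hcore.trans hpairs) (sq_nonneg _)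
    _ = S := by field_simp
    _ ≤ ((k + 1 : ℕ) : ℝ) * (2 ^ k * (k : ℝ) ^ k * (n : ℝ) ^ (-a)) := hSle
    _ = ((k + 1 : ℕ) : ℝ) * (2 ^ k * (k : ℝ) ^ k) * (n : ℝ) ^ (-a) := by ring
    _ ≤ (n : ℝ) ^ (a / 2) * (n : ℝ) ^ (-a) :=
        mul_le_mul_of_nonneg_right hK₁ (Real.rpow_nonneg hn0.le _)
    _ = ((n : ℝ) ^ (-(a / 4))) ^ 2 := by
        rw [← Real.rpow_add hn0, ← Real.rpow_natCast, ← Real.rpow_mul hn0.le]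
        congr 1
        push_cast
        ring

end Summit.PneNP.PneNP.Theorems.SingleThreshold

end
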